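import Literature.LinearAlgebra.Matrix.RealBilinearSwapTensorInvariance      -- ★ A-p14: `Ad(U(H))`-invariance of the swap ∕ twin double sums (general `N`)
import Mathlib.Analysis.SpecialFunctions.Pow.Real
import HarnessLib

/-!
# The Casimir of `𝔲(diag e)` in matrix units, root pair by root pair (any `N`): `q(X̂,X̂) + q(Ŷ,Ŷ)`, `−(q(X,X) + q(Y,Y))` and `−2q(iE_kk,iE_kk)` are the `{k,l}`- and `k`-blocks of
# `Σ_{k,l} [q(E_kl,E_lk) − q(iE_kl,iE_lk)] − Σ_{k,l} re(e_l∕e_k)•[q(E_kl,E_kl) + q(iE_kl,iE_kl)]` (Hall GTM 222 Prop. 3.24; ★ Z1 `casimir_eq_swap_sub_twin_add_center` for `N = 2`)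

Topic `NumberTheory/Automorphic`; namespace `Literature.NumberTheory.Automorphic.RootVectors`.  THEOREMS ONLY (no `def`, no instance, no notation, no axiom, no named fact, no `sorry`).
Cell `pub/hodgecm-mathlib`, ENGINE T1 (crux H413 = `stmt-HodgeConjecture-24833`); ROAD A owner word 2026-09-01T12:22:33Z (o2′) «RANK-2 CASIMIR RADIAL EQUATION» (census bac477e2), FILE B.
Author A-p18 (g26), 2026-09-01.

WHAT IS PROVED, for every REAL-bilinear `q : M_N(ℂ) × M_N(ℂ) → E`, `e : Fin N → ℂ` and `k ≠ l` (root vectors of ★ A1 `ArchUnitaryRootVectors`, `pq = 1`):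
* `swap_sub_twin_pair_eq_boost` (NONCOMPACT pair, `q²e_l = −e_k`): the `(k,l) + (l,k)` block of the double sum above equals `q(X̂,X̂) + q(Ŷ,Ŷ)`, `X̂ = pE_kl + qE_lk`, `Ŷ = −ipE_kl + iqE_lk`;
* `swap_sub_twin_pair_eq_rotation` (COMPACT pair, `q²e_l = e_k`): the block equals `−(q(X,X) + q(Y,Y))`, `X = pE_kl − qE_lk`, `Y = ipE_kl + iqE_lk`;
* `swap_sub_twin_diag_eq` (`e_k ≠ 0`): the `(k,k)` term equals `−2•q(iE_kk, iE_kk)`.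
So twice the Casimir of `𝔲(diag e)` for the trace form, `−2Σ_k q(iE_kk)² + Σ_{nc} [q(X̂)² + q(Ŷ)²] − Σ_{c} [q(X)² + q(Y)²]`, is the `Ad(U(diag e))`-invariant double sum of ★ A-p14
(`sum_sum_conj_single_swap_eq`, `sum_sum_smul_conj_single_same_eq`); the bookkeeping over pairs for a given sign pattern is left to the user (FILE D does `N = 3`, `(+,+,−)`).
HONEST LABEL: finite-dimensional linear algebra; pays nothing by itself (HC_CM is proved only modulo the printed citations until rung 0 closes).

## References
* [Hall2015] B. C. Hall, *Lie Groups, Lie Algebras, and Representations*, 2nd ed., GTM 222 (2015), §3.6, Prop. 3.24.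
* [Varadarajan1989] V. S. Varadarajan, *An Introduction to Harmonic Analysis on Semisimple Lie Groups* (1989), §6.3.
-/

set_option autoImplicit false

namespace Literature.NumberTheory.Automorphic.RootVectors

open Complex Matrix
open scoped ComplexConjugate

variable {N : ℕ} {E : Type*} [AddCommGroup E] [Module ℝ E]

/-- Complex scalars that are real act through the real structure: `(r : ℂ)•A = r•A`, `(r·i)•A = r•(i•A)`, `(−(r·i))•A = (−r)•(i•A)`. [cite: Hall2015, §3.6] -/
theorem ofReal_mul_I_smul (r : ℝ) (A : Matrix (Fin N) (Fin N) ℂ) :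
    ((r : ℂ) * I) • A = r • (I • A) ∧ (-((r : ℂ) * I)) • A = (-r) • (I • A) ∧ (r : ℂ) • A = r • A := by
  refine ⟨by rw [mul_smul, Complex.coe_smul], ?_, Complex.coe_smul r A⟩
  rw [show (-((r : ℂ) * I)) = ((-r : ℝ) : ℂ) * I by push_cast; ring, mul_smul, Complex.coe_smul]

/-- The weights of a NONCOMPACT pair: `q²e_l = −e_k`, `pq = 1`, `e_l ≠ 0` ⇒ `re(e_l∕e_k) = −p²`, `re(e_k∕e_l) = −q²`. [cite: Hall2015, §3.6] -/
theorem weights_of_boostPair {p q : ℝ} (hpq : p * q = 1) {e : Fin N → ℂ} {k l : Fin N} (hl : e l ≠ 0) (hqe : (q : ℂ) ^ 2 * e l = -e k) :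
    (e l / e k).re = -p ^ 2 ∧ (e k / e l).re = -q ^ 2 := by
  have hq0 : q ≠ 0 := by rintro rfl; simp at hpq
  have hp : p = q⁻¹ := eq_inv_of_mul_eq_one_left hpq
  have hk : e k = -((q : ℂ) ^ 2 * e l) := by rw [hqe, neg_neg]
  refine ⟨?_, ?_⟩
  · rw [hk, hp, div_neg, Complex.neg_re, mul_comm, ← div_div, div_self hl, one_div, ← inv_pow, ← Complex.ofReal_inv, ← Complex.ofReal_pow, Complex.ofReal_re]
  · rw [hk, neg_div, Complex.neg_re, mul_div_assoc, div_self hl, mul_one, ← Complex.ofReal_pow, Complex.ofReal_re]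

/-- The weights of a COMPACT pair: `q²e_l = e_k`, `pq = 1`, `e_l ≠ 0` ⇒ `re(e_l∕e_k) = p²`, `re(e_k∕e_l) = q²`. [cite: Hall2015, §3.6] -/
theorem weights_of_rotationPair {p q : ℝ} (hpq : p * q = 1) {e : Fin N → ℂ} {k l : Fin N} (hl : e l ≠ 0) (hqe : (q : ℂ) ^ 2 * e l = e k) :
    (e l / e k).re = p ^ 2 ∧ (e k / e l).re = q ^ 2 := by
  have hq0 : q ≠ 0 := by rintro rfl; simp at hpq
  have hp : p = q⁻¹ := eq_inv_of_mul_eq_one_left hpq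
  refine ⟨?_, ?_⟩
  · rw [← hqe, hp, mul_comm, ← div_div, div_self hl, one_div, ← inv_pow, ← Complex.ofReal_inv, ← Complex.ofReal_pow, Complex.ofReal_re]
  · rw [← hqe, mul_div_assoc, div_self hl, mul_one, ← Complex.ofReal_pow, Complex.ofReal_re]

/-- **NONCOMPACT root pair vs. the swap∕twin double sum.**  For `k ≠ l`, `pq = 1`, `q²e_l = −e_k` (`e_l ≠ 0`) and every real-bilinear `q`:
`q(X̂,X̂) + q(Ŷ,Ŷ) = [q(E_kl,E_lk) − q(iE_kl,iE_lk)] + [q(E_lk,E_kl) − q(iE_lk,iE_kl)] − (re(e_l∕e_k)•[q(E_kl,E_kl) + q(iE_kl,iE_kl)] + re(e_k∕e_l)•[q(E_lk,E_lk) + q(iE_lk,iE_lk)])`.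
[cite: Hall2015, Prop. 3.24] -/
theorem swap_sub_twin_pair_eq_boost (B : Matrix (Fin N) (Fin N) ℂ →ₗ[ℝ] Matrix (Fin N) (Fin N) ℂ →ₗ[ℝ] E) {p q : ℝ} (hpq : p * q = 1)
    {e : Fin N → ℂ} {k l : Fin N} (hl : e l ≠ 0) (hqe : (q : ℂ) ^ 2 * e l = -e k) :
    B ((p : ℂ) • Matrix.single k l (1 : ℂ) + (q : ℂ) • Matrix.single l k (1 : ℂ)) ((p : ℂ) • Matrix.single k l (1 : ℂ) + (q : ℂ) • Matrix.single l k (1 : ℂ)) +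
        B ((-((p : ℂ) * I)) • Matrix.single k l (1 : ℂ) + ((q : ℂ) * I) • Matrix.single l k (1 : ℂ))
          ((-((p : ℂ) * I)) • Matrix.single k l (1 : ℂ) + ((q : ℂ) * I) • Matrix.single l k (1 : ℂ)) =
      (B (Matrix.single k l 1) (Matrix.single l k 1) - B (I • Matrix.single k l (1 : ℂ)) (I • Matrix.single l k (1 : ℂ))) +
        (B (Matrix.single l k 1) (Matrix.single k l 1) - B (I • Matrix.single l k (1 : ℂ)) (I • Matrix.single k l (1 : ℂ))) -
        ((e l / e k).re • (B (Matrix.single k l 1) (Matrix.single k l 1) + B (I • Matrix.single k l (1 : ℂ)) (I • Matrix.single k l (1 : ℂ))) +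
          (e k / e l).re • (B (Matrix.single l k 1) (Matrix.single l k 1) + B (I • Matrix.single l k (1 : ℂ)) (I • Matrix.single l k (1 : ℂ)))) := by
  obtain ⟨hw₁, hw₂⟩ := weights_of_boostPair hpq hl hqe
  rw [hw₁, hw₂, (ofReal_mul_I_smul p (Matrix.single k l (1 : ℂ))).2.2, (ofReal_mul_I_smul q (Matrix.single l k (1 : ℂ))).2.2,
    (ofReal_mul_I_smul p (Matrix.single k l (1 : ℂ))).2.1, (ofReal_mul_I_smul q (Matrix.single l k (1 : ℂ))).1]
  simp only [map_add, map_smul, LinearMap.add_apply, LinearMap.smul_apply]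
  linear_combination (norm := module) hpq • (B (Matrix.single k l 1) (Matrix.single l k 1) + B (Matrix.single l k 1) (Matrix.single k l 1) -
    B (I • Matrix.single k l (1 : ℂ)) (I • Matrix.single l k (1 : ℂ)) - B (I • Matrix.single l k (1 : ℂ)) (I • Matrix.single k l (1 : ℂ)))

/-- **COMPACT root pair vs. the swap∕twin double sum.**  For `k ≠ l`, `pq = 1`, `q²e_l = e_k` (`e_l ≠ 0`) and every real-bilinear `q`:
`−(q(X,X) + q(Y,Y)) = [q(E_kl,E_lk) − q(iE_kl,iE_lk)] + [q(E_lk,E_kl) − q(iE_lk,iE_kl)] − (re(e_l∕e_k)•[…kl…] + re(e_k∕e_l)•[…lk…])`, `X = pE_kl − qE_lk`, `Y = ipE_kl + iqE_lk`.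
[cite: Hall2015, Prop. 3.24] -/
theorem swap_sub_twin_pair_eq_rotation (B : Matrix (Fin N) (Fin N) ℂ →ₗ[ℝ] Matrix (Fin N) (Fin N) ℂ →ₗ[ℝ] E) {p q : ℝ} (hpq : p * q = 1)
    {e : Fin N → ℂ} {k l : Fin N} (hl : e l ≠ 0) (hqe : (q : ℂ) ^ 2 * e l = e k) :
    -(B ((p : ℂ) • Matrix.single k l (1 : ℂ) - (q : ℂ) • Matrix.single l k (1 : ℂ)) ((p : ℂ) • Matrix.single k l (1 : ℂ) - (q : ℂ) • Matrix.single l k (1 : ℂ)) +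
        B (((p : ℂ) * I) • Matrix.single k l (1 : ℂ) + ((q : ℂ) * I) • Matrix.single l k (1 : ℂ))
          (((p : ℂ) * I) • Matrix.single k l (1 : ℂ) + ((q : ℂ) * I) • Matrix.single l k (1 : ℂ))) =
      (B (Matrix.single k l 1) (Matrix.single l k 1) - B (I • Matrix.single k l (1 : ℂ)) (I • Matrix.single l k (1 : ℂ))) +
        (B (Matrix.single l k 1) (Matrix.single k l 1) - B (I • Matrix.single l k (1 : ℂ)) (I • Matrix.single k l (1 : ℂ))) -
        ((e l / e k).re • (B (Matrix.single k l 1) (Matrix.single k l 1) + B (I • Matrix.single k l (1 : ℂ)) (I • Matrix.single k l (1 : ℂ))) +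
          (e k / e l).re • (B (Matrix.single l k 1) (Matrix.single l k 1) + B (I • Matrix.single l k (1 : ℂ)) (I • Matrix.single l k (1 : ℂ)))) := by
  obtain ⟨hw₁, hw₂⟩ := weights_of_rotationPair hpq hl hqe
  rw [hw₁, hw₂, (ofReal_mul_I_smul p (Matrix.single k l (1 : ℂ))).2.2, (ofReal_mul_I_smul q (Matrix.single l k (1 : ℂ))).2.2,
    (ofReal_mul_I_smul p (Matrix.single k l (1 : ℂ))).1, (ofReal_mul_I_smul q (Matrix.single l k (1 : ℂ))).1]
  simp only [map_add, map_sub, map_smul, LinearMap.add_apply, LinearMap.sub_apply, LinearMap.smul_apply]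
  linear_combination (norm := module) hpq • (B (Matrix.single k l 1) (Matrix.single l k 1) + B (Matrix.single l k 1) (Matrix.single k l 1) -
    B (I • Matrix.single k l (1 : ℂ)) (I • Matrix.single l k (1 : ℂ)) - B (I • Matrix.single l k (1 : ℂ)) (I • Matrix.single k l (1 : ℂ)))

/-- **Diagonal generator vs. the swap∕twin double sum**: for `e_k ≠ 0`, `−2•q(iE_kk, iE_kk) = [q(E_kk,E_kk) − q(iE_kk,iE_kk)] − re(e_k∕e_k)•[q(E_kk,E_kk) + q(iE_kk,iE_kk)]`.
[cite: Hall2015, Prop. 3.24] -/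
theorem swap_sub_twin_diag_eq (B : Matrix (Fin N) (Fin N) ℂ →ₗ[ℝ] Matrix (Fin N) (Fin N) ℂ →ₗ[ℝ] E) {e : Fin N → ℂ} {k : Fin N} (hk : e k ≠ 0) :
    (B (Matrix.single k k 1) (Matrix.single k k 1) - B (I • Matrix.single k k (1 : ℂ)) (I • Matrix.single k k (1 : ℂ))) -
        (e k / e k).re • (B (Matrix.single k k 1) (Matrix.single k k 1) + B (I • Matrix.single k k (1 : ℂ)) (I • Matrix.single k k (1 : ℂ))) =
      -((2 : ℝ) • B (I • Matrix.single k k (1 : ℂ)) (I • Matrix.single k k (1 : ℂ))) := by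
  rw [div_self hk, Complex.one_re, one_smul, two_smul]
  abel

end Literature.NumberTheory.Automorphic.RootVectors
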